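import Summits.QuantumFields.YangMills.Theorems.BalabanUVNodesN07NormalisationCrossingEnds
import HarnessLib

/-!
# N07 [B11] (= [15] = [Balaban1985Variational]) Sect. F — TWO FACES OF THE NORMALISATION OF RECORD `NrmOfRecord`: the INTERIOR face (at interior datums print's local family
# `D″` has the pure cube tower's cells, so a normalisation on those cells IS `NrmOfRecord`) and the A6 NON-VACUITY face (the unit configuration with the unit gauge satisfies it at every datum)

Cell `pub-ymgap`, seat `pub-ymgap-dag-n07-e` g23 (FAN-OUT §N07 row s3; LANE OWNER of the K0 road), MODULE 63, INTENT-63 (cell bus 2026-08-28T19:11Z).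
`--kind proof --supports stmt-QuantumFields-20541 --as helper` (K0⁷; dag-lead KEY MAP v2); count-neutral; def-free.
[15] = [Balaban1985Variational]; [3] = [Balaban1985Averaging]; [6] = [Balaban1985RegularSpaces]; [4] = [Balaban1984PropagatorsII].

WHY.  (1) The (α) pen (dag-n07-w3's successor: export of `GaugedBoundB8`'s (1.29) `Restr129` + torus push-down) delivers a normalisation on the PURE cube tower's cells `Λ′_{j′}(□)`;
`NrmOfRecord` (MODULE 60, p655779) is stated on the cells of print's local family `D″ = domainsMeet (cubeDomains …) (domainsOfSeq s.Ω j ·)`.  At INTERIOR datums — the cube tower levelwise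
inside the record's truncated family, `(cubeDomains …).Om j′ ⊆ (domainsOfSeq s.Ω j ·).Om j′` for all `j′` — the two families have THE SAME regions (`domainsMeet_Om_of_le`), hence the same
cells `LamSite`, so the cube-cell normalisation IS `NrmOfRecord` (§1).  (2) A displayed predicate should be visibly inhabited (A6 hygiene; ref-G READ436 NOTE-2's spirit): at `U = 1`,
`u = 1` the witness is `w := 1` (residual; the unit configuration carries the radial tower, dag-n07-w6 `radialTower_one`), the coarse axial gauge of the unit data is `1`
(`axialGauge_one`, from `B8Ineq130.axialFn_one`), so `g ≡ 1` and `R̄^{j′}1 = 1` at every level (MODULE 61's one-step lemma iterated) — §2.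

WHAT IS PROVED (sorry-free; no definition; axioms standard; bookkeeping — NOTHING of [15]∕[3]∕[6] analysis).  §1 `lamSite_meet_iff_left_of_le` (any `Domains D₁ ≤ D₂`) · ★★
`nrmOfRecord_of_cubeCells_of_interior`.  §2 ★ `axialGauge_one` · `gaugeAvgIter_const_one` · ★★ `nrmOfRecord_one_one`.

HONEST SCOPE.  Count-neutral; §1 is an implication between two displayed shapes (nothing discharged: the cube-cell normalisation is the (α) pen's deliverable), §2 an A6 witness at the unit
configuration only; `NrmOfRecord` ∕ HS3NORM ∕ HCHART-MEET-NORM ∕ HBUDGET-NORM stay displayed in MODULE 59's knit; stub 1-G‴ ∕ K0⁷ ∕ K1⁹ NOT closed; N07 ∕ N05 NOT discharged; counts unmoved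
(typed 28∕28 · discharged 5∕27); one finite 𝕋⁴ programme at fixed ε — the route closes the conditional finite-𝕋⁴ rung `BalabanLadder.UV` ONLY; the YM mass gap (Clay) is NOT proved by any of
this; nothing continuum ∕ ℝ⁴ ∕ OS.  No `sorry`, no `def`, no `instance`, no `notation`.

References: [15] (147) p. 301, (150)–(154) pp. 301–302; [3] (78)–(81) p. 30; [6] (1.14)–(1.15) p. 78, (1.29) p. 81, (1.131) p. 99; [4] (2.1)–(2.3) p. 224.
-/

set_option autoImplicit false

noncomputable section

namespace Summit.QuantumFields.YangMills.BalabanUVNodes.N07NormalisationOfRecordFaces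

open Literature.MathematicalPhysics.QuantumFieldTheory.Balaban1983to89
open Literature.MathematicalPhysics.QuantumFieldTheory.Balaban1983to89.Node00
open T4Continuum (T4Family)
open T4AxialGaugeSmallField (axialGauge)
open B12GaugeOrbits021 (IsResidual)
open B15Eq177GaugeInvariance (blockLift)
open B14DomainGeom (Pt)
open B8Eq131Cubes (sqLo sqHi)
open B6SectADomainsV1 (Domains)
open GaugeField (gaugeAct)
open ExpMeanLog (expMeanLogSU)
open Summit.QuantumFields.Balaban3D.Carriers (radialContourData)
open Summit.QuantumFields.YangMills.BalabanUVNodes.N07NormalisationOfRecord (NrmOfRecord)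
open Summit.QuantumFields.YangMills.BalabanUVNodes.N07NormalisationCrossingEnds (gaugeAvgIter_succ_eq_one_of_forall_block)
open Summit.QuantumFields.YangMills.BalabanUVNodes.N07RadialAxialTower (radialTower_one)

/-! ## §1  The interior face: at interior datums the local family has the cube tower's cells -/

section Interior

variable {P : Params}

/-- If `D₁` is levelwise inside `D₂`, the meet `D₁ ⊓ D₂` has the cells of `D₁`: `Λ_{j}(D₁ ⊓ D₂) = Λ_j(D₁)` (regions by `domainsMeet_Om_of_le`, depth one level up likewise).
[cite: Balaban1984PropagatorsII, (2.1)–(2.3) p.224; Balaban1985Variational, (150) p.301] -/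
theorem lamSite_meet_iff_left_of_le {D₁ D₂ : Domains P} (h : ∀ j : ℕ, D₁.Om j ⊆ D₂.Om j) (j : ℕ) (y : Site P j) :
    (domainsMeet D₁ D₂).LamSite j y ↔ D₁.LamSite j y := by
  unfold Domains.LamSite Domains.Deep
  rw [domainsMeet_Om_of_le h j, domainsMeet_Om_of_le h (j + 1)]

variable {F : T4Family} {N : ℕ} [NeZero N]

/-- ★★ **THE INTERIOR FACE OF `NrmOfRecord`** — the (α) pen's landing spot: at an INTERIOR datum (the cube tower `{□_{j′}}` of the datum levelwise inside the record's truncated family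
`domainsOfSeq s.Ω j`), a residual radial axialiser `w` together with the normalisation `R̄^{j′}g = 1`, `g = h̄·w·u⁻¹`, on the PURE CUBE TOWER's cells `Λ′_{j′}(□)` (what [6] (1.29) `Restr129`
pushed through the cover delivers) IS the normalisation of record at that datum (print's local family there is the cube tower: `Ω′_{j′} = □_{j′} ∩ Ω_{j′} = □_{j′}`).
[cite: Balaban1985Variational, (147) p.301, (150)–(152) p.301; Balaban1985RegularSpaces, (1.29) p.81, (1.131) p.99; Balaban1985Averaging, (78)–(81) p.30] -/
theorem nrmOfRecord_of_cubeCells_of_interior {Mc ρ : ℕ} {ν : Stage7Numerics} {M : ℕ} {g : ℕ → ℝ} {K k : ℕ} {s : SeqOfRecord F ν M g K k}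
    {U : GaugeField (F.P K) 0 (SU N)} {j : ℕ} {idx : Pt (F.P K).d} {u : GaugeTransf (F.P K) 0 (SU N)} {A : PBond (F.P K) 0 → MatA N}
    (hint : ∀ (hk : j ≤ (F.P K).m + (F.P K).K) (j' : ℕ),
      (cubeDomains (F.P K) (cornerP (F.P K) Mc ρ idx) (sideP (F.P K) Mc ρ) ρ j hk).Om j' ⊆ (domainsOfSeq s.Ω j hk).Om j')
    {w : GaugeTransf (F.P K) 0 (SU N)} (hres : IsResidual j w)
    (hax : ∀ i < j, AxialGauge (radialContourData (F.P K) i (SU N)) (Averaging.iter (avOfRecord F N K) i (gaugeAct w U)))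
    (hcube : ∀ (hk : j ≤ (F.P K).m + (F.P K).K) (j' : ℕ), j' ≤ j → ∀ y : Site (F.P K) j',
      (cubeDomains (F.P K) (cornerP (F.P K) Mc ρ idx) (sideP (F.P K) Mc ρ) ρ j hk).LamSite j' y →
        gaugeAvgIter (loopAvgBlockOp expMeanLogSU)
            (fun x => blockLift j (axialGauge (Averaging.iter (avOfRecord F N K) j (gaugeAct w U))
                (sqLo (F.P K).L (cornerP (F.P K) Mc ρ idx) ρ j j - 1) (sqHi (F.P K).L (cornerP (F.P K) Mc ρ idx) (sideP (F.P K) Mc ρ) ρ j j + 1)) x *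
              w x * (u x)⁻¹) j' y = 1) :
    NrmOfRecord F N Mc ρ ν M g K k s U j idx u A :=
  ⟨w, hres, hax, fun hk j' hj' y hy => hcube hk j' hj' y ((lamSite_meet_iff_left_of_le (hint hk) j' y).mp hy)⟩

end Interior

/-! ## §2  The A6 face: the unit configuration with the unit gauge -/

section Witness

variable {P : Params} {G : Type*} [GaugeGroup G]

/-- The coarse axial gauge of the unit data is the unit gauge function (`B8Ineq130.axialFn_one` on the image of the box, `1` off it by definition). [folklore] -/
theorem axialGauge_one {j : ℕ} (lo hi : Fin P.d → ℤ) : axialGauge (1 : GaugeField P j G) lo hi = fun _ => 1 := by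
  funext s
  unfold axialGauge
  split_ifs with h
  · exact B8Ineq130.axialFn_one _ _
  · rfl

/-- `R̄^{i}1 = 1` at every level `i ≤ m + K` (MODULE 61's one-step lemma iterated; `ℰ{1} = 1`). [cite: Balaban1985Averaging, (79)–(80) p.30 (bookkeeping)] -/
theorem gaugeAvgIter_const_one (ℰ : LoopAverage G) (hE : ∀ n : ℕ, ℰ.E (fun _ : Fin (n + 1) => (1 : G)) = 1) :
    ∀ i : ℕ, i ≤ P.m + P.K → ∀ y : Site P i, gaugeAvgIter (loopAvgBlockOp ℰ) (fun _ : Site P 0 => (1 : G)) i y = 1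
  | 0, _, _ => rfl
  | i + 1, hi, _ => gaugeAvgIter_succ_eq_one_of_forall_block ℰ hE hi _ fun x _ => gaugeAvgIter_const_one ℰ hE i (Nat.le_of_succ_le hi) x

variable {F : T4Family} {N : ℕ} [NeZero N]

/-- ★★ **A6 NON-VACUITY OF THE NORMALISATION OF RECORD**: at the unit configuration `U = 1` with S3's gauge `u = 1`, `NrmOfRecord F N Mc ρ … 1 j idx 1 A` holds at EVERY datum and run —
witness `w := 1` (residual; the unit configuration carries the radial tower, dag-n07-w6 `radialTower_one`), `h = axialGauge (M^j 1) … = 1` (`iter_avOfRecord_one`, `axialGauge_one`),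
`g ≡ 1`, `R̄^{j′}1 = 1` (`gaugeAvgIter_const_one`, `expMeanLogSU_E_one'`). [cite: Balaban1985Variational, (152) p.301 (bookkeeping); Balaban1985Averaging, (78)–(81) p.30] -/
theorem nrmOfRecord_one_one (Mc ρ : ℕ) (ν : Stage7Numerics) (M : ℕ) (g : ℕ → ℝ) (K k : ℕ) (s : SeqOfRecord F ν M g K k) (j : ℕ) (idx : Pt (F.P K).d)
    (A : PBond (F.P K) 0 → MatA N) :
    NrmOfRecord F N Mc ρ ν M g K k s (1 : GaugeField (F.P K) 0 (SU N)) j idx (fun _ => (1 : SU N)) A := by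
  refine ⟨fun _ => 1, fun _ => rfl, ?_, ?_⟩
  · intro i _
    rw [B12RTGaugeInvariance254.gaugeAct_one']
    exact radialTower_one F N K i
  · intro hk j' hj' y _
    have hg : (fun x : Site (F.P K) 0 => blockLift j (axialGauge (Averaging.iter (avOfRecord F N K) j
          (gaugeAct (fun _ => (1 : SU N)) (1 : GaugeField (F.P K) 0 (SU N))))
          (sqLo (F.P K).L (cornerP (F.P K) Mc ρ idx) ρ j j - 1) (sqHi (F.P K).L (cornerP (F.P K) Mc ρ idx) (sideP (F.P K) Mc ρ) ρ j j + 1)) x *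
        (1 : SU N) * ((fun _ : Site (F.P K) 0 => (1 : SU N)) x)⁻¹) = fun _ => 1 := by
      funext x
      rw [B12RTGaugeInvariance254.gaugeAct_one', B15Claim189UnitTestAtRecord.iter_avOfRecord_one F N K j, axialGauge_one]
      simp [blockLift]
    rw [hg]
    exact gaugeAvgIter_const_one expMeanLogSU (expMeanLogSU_E_one' N) j' (hj'.trans hk) y

end Witness

end Summit.QuantumFields.YangMills.BalabanUVNodes.N07NormalisationOfRecordFaces

end
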